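import Mathlib
import Literature.GroupTheory.PermutationGroups.SmallIndexSubgroups

/-!
# Entropy support theorem, layer 2: normal subgroups of groups inducing the alternating group on
# an invariant set

Helper file for stub `entropySupportTheorem` of crux `SymmetryBudget.WindowBarrier`
(item stmt-PneNP-2145, line `bijection-gauge-twin-iso`).  Everything is phrased "set-wise" for
subgroups of `Sym(β)` and an invariant finite set `B ⊆ β`, so that later layers never change the
ambient type:

* `EST.exists_isThreeCycle_not_commute` — a permutation moving a point of `B` (`|B| ≥ 4`) fails
  to commute with some 3-cycle supported in `B` (the centraliser of `Alt(B)` is trivial);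
* `est_trivial_or_full_of_normal` — **the dichotomy**: if `L ≤ Sym(β)` induces at least `Alt(B)`
  on `B` (`|B| ≥ 5`) and normalises `M ≤ Sym(β)` (both leaving `B` invariant), then `M` acts
  trivially on `B` or `M` too induces at least `Alt(B)` on `B` (simplicity of `Alt(B)`, Mathlib's
  `alternatingGroup.normal_subgroup_eq_bot_or_eq_top`, plus the centraliser fact);
* counting through restriction homomorphisms (`Literature…restr`):
  `|S| = |S ∩ Fix(p)| · |S|_p|` (`EST.card_eq_card_inf_fixing_mul_card_range`), restriction is
  injective on a subgroup fixing the complement (`EST.card_range_restr_of_fix_compl`), and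
  `|X| ≤ |B|! · |X ∩ Fix(B)|` (`EST.card_le_factorial_mul_card_inf_fixing`).

No definitions (kernel-only helper file).
-/

-- `Summit.PneNP.PneNP.…` duplicates `PneNP` BY DESIGN (single-problem summit).
set_option linter.dupNamespace false

namespace Summit.PneNP.PneNP.Theorems

open Equiv Equiv.Perm MulAction Subgroup
open Literature.GroupTheory.PermutationGroups (restr restr_apply_coe)

namespace EST

variable {β : Type*} [Fintype β] [DecidableEq β]

omit [Fintype β] in
/-- A permutation whose moved points lie in `B` leaves `B` invariant. -/
theorem apply_mem_iff_of_moved_subset {σ : Perm β} {B : Finset β} (h : ∀ u, σ u ≠ u → u ∈ B)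
    (u : β) : σ u ∈ B ↔ u ∈ B := by
  by_cases hu : σ u = u
  · rw [hu]
  · have h2 : σ (σ u) ≠ σ u := fun e => hu (σ.injective e)
    exact ⟨fun _ => h u hu, fun _ => h _ h2⟩

omit [Fintype β] in
/-- A permutation whose moved points lie in `B` fixes every point outside `B`. -/
theorem apply_eq_self_of_not_mem {σ : Perm β} {B : Finset β} (h : ∀ u, σ u ≠ u → u ∈ B)
    (u : β) (hu : u ∉ B) : σ u = u := by
  by_contra hne
  exact hu (h u hne)

/-- **Trivial centraliser of `Alt(B)`**: if `σ` moves a point `u ∈ B` and `|B| ≥ 4`, some 3-cycle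
supported in `B` does not commute with `σ`. -/
theorem exists_isThreeCycle_not_commute (B : Finset β) (hB : 4 ≤ B.card) (σ : Perm β) (u : β)
    (hu : u ∈ B) (hσu : σ u ≠ u) :
    ∃ τ : Perm β, τ.IsThreeCycle ∧ (∀ x, τ x ≠ x → x ∈ B) ∧ τ * σ ≠ σ * τ := by
  obtain ⟨z, hz, w, hw, hzw⟩ : ∃ z ∈ (B.erase u).erase (σ u), ∃ w ∈ (B.erase u).erase (σ u), z ≠ w := by
    have h1 : (B.erase u).card = B.card - 1 := Finset.card_erase_of_mem hu
    have h2 : (B.erase u).card - 1 ≤ ((B.erase u).erase (σ u)).card := Finset.pred_card_le_card_erase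
    exact Finset.one_lt_card.1 (by omega)
  simp only [Finset.mem_erase] at hz hw
  refine ⟨swap u z * swap u w, isThreeCycle_swap_mul_swap_same (Ne.symm hz.2.1) (Ne.symm hw.2.1) hzw,
    ?_, ?_⟩
  · intro x hx
    by_contra hxB
    apply hx
    have hxu : x ≠ u := fun h => hxB (h ▸ hu)
    have hxz : x ≠ z := fun h => hxB (h ▸ hz.2.2)
    have hxw : x ≠ w := fun h => hxB (h ▸ hw.2.2)
    rw [Perm.mul_apply, swap_apply_of_ne_of_ne hxu hxw, swap_apply_of_ne_of_ne hxu hxz]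
  · intro h
    have h1 := congrArg (fun τ : Perm β => τ u) h
    simp only [Perm.mul_apply, swap_apply_left] at h1
    rw [swap_apply_of_ne_of_ne hσu (Ne.symm hw.1), swap_apply_of_ne_of_ne hσu (Ne.symm hz.1),
      swap_apply_of_ne_of_ne hw.2.1 hzw.symm] at h1
    exact hw.2.1 (σ.injective h1.symm)

end EST

open EST in
/-- **The dichotomy for normalised subgroups.**  Let `B ⊆ β` have at least `5` points, let
`L, M ≤ Sym(β)` leave `B` invariant, suppose every even permutation of `β` supported in `B` agrees
on `B` with an element of `L` (i.e. `L` induces at least `Alt(B)` on `B`), and suppose `L`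
normalises `M`.  Then either `M` acts trivially on `B`, or `M` too induces at least `Alt(B)` on `B`.
(Proof: `M|_B ∩ Alt(B)` is normal in the simple group `Alt(B)`; if it is trivial, commutators with
3-cycles show that `M|_B` centralises `Alt(B)`, hence is trivial.) -/
theorem est_trivial_or_full_of_normal :
    ∀ {β : Type*} [Fintype β] [DecidableEq β] (B : Finset β) (L M : Subgroup (Equiv.Perm β)),
      5 ≤ B.card → (∀ l ∈ L, ∀ u, l u ∈ B ↔ u ∈ B) → (∀ m ∈ M, ∀ u, m u ∈ B ↔ u ∈ B) →
      (∀ σ : Equiv.Perm β, Equiv.Perm.sign σ = 1 → (∀ u, σ u ≠ u → u ∈ B) →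
        ∃ l ∈ L, ∀ u ∈ B, l u = σ u) →
      (∀ l ∈ L, ∀ m ∈ M, l * m * l⁻¹ ∈ M) →
      (∀ m ∈ M, ∀ u ∈ B, m u = u) ∨
        ∀ σ : Equiv.Perm β, Equiv.Perm.sign σ = 1 → (∀ u, σ u ≠ u → u ∈ B) →
          ∃ m ∈ M, ∀ u ∈ B, m u = σ u := by
  intro β _ _ B L M hB hLB hMB hfull hnorm
  classical
  set resM := restr M (fun u => u ∈ B) hMB with hresM
  set M' : Subgroup (Perm {u // u ∈ B}) := resM.range with hM'
  set A := alternatingGroup {u // u ∈ B} with hA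
  set N : Subgroup A := M'.comap A.subtype with hN
  have hcardB : 5 ≤ Nat.card {u // u ∈ B} := by
    rw [Nat.card_eq_fintype_card, Fintype.card_coe]; exact hB
  -- every even permutation of `B` is induced by some `l ∈ L`
  have hlift : ∀ a : Perm {u // u ∈ B}, sign a = 1 →
      ∃ l, ∃ hl : l ∈ L, l.subtypePerm (hLB l hl) = a := by
    intro a ha
    have h1 : sign (ofSubtype a) = 1 := by rw [sign_ofSubtype]; exact ha
    have h2 : ∀ u, ofSubtype a u ≠ u → u ∈ B := fun u hu => by
      by_contra h; exact hu (ofSubtype_apply_of_not_mem a h)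
    obtain ⟨l, hl, hlu⟩ := hfull _ h1 h2
    refine ⟨l, hl, ?_⟩
    ext ⟨u, hu⟩
    show l u = ((a ⟨u, hu⟩ : {u // u ∈ B}) : β)
    rw [hlu u hu, ofSubtype_apply_of_mem a hu]
  -- conjugating a restriction by the restriction of `l`
  have hconj : ∀ (l : Perm β) (hl : l ∈ L) (m : M),
      resM ⟨l * m * l⁻¹, hnorm l hl m m.2⟩ =
        l.subtypePerm (hLB l hl) * resM m * (l.subtypePerm (hLB l hl))⁻¹ := by
    intro l hl m
    rw [eq_mul_inv_iff_mul_eq]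
    ext ⟨u, hu⟩
    simp [hresM, Perm.mul_apply, subtypePerm_apply]
  haveI hNn : N.Normal := by
    refine ⟨fun x hx a => ?_⟩
    rw [hN, Subgroup.mem_comap] at hx ⊢
    obtain ⟨m, hm⟩ := hx
    obtain ⟨l, hl, hla⟩ := hlift (a : Perm _) (Perm.mem_alternatingGroup.1 a.2)
    refine ⟨⟨l * m * l⁻¹, hnorm l hl m m.2⟩, ?_⟩
    rw [hconj l hl m]
    simp only [Subgroup.coe_subtype, Subgroup.coe_mul, InvMemClass.coe_inv]
    rw [hla, hm]
    rfl
  rcases alternatingGroup.normal_subgroup_eq_bot_or_eq_top hcardB (N := N) with hbot | htop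
  · ---------------------------------------------------------------- `M` is trivial on `B`
    left
    by_contra hcon
    push Not at hcon
    obtain ⟨m, hm, u, hu, hmu⟩ := hcon
    obtain ⟨τ, hτ3, hτB, hτm⟩ := exists_isThreeCycle_not_commute B (by omega) m u hu hmu
    obtain ⟨l, hl, hlτ⟩ := hfull τ hτ3.sign hτB
    have hcM : l * m * l⁻¹ * m⁻¹ ∈ M := M.mul_mem (hnorm l hl m hm) (M.inv_mem hm)
    -- the restriction of the commutator is even, hence trivial
    have hsign : sign (resM ⟨l * m * l⁻¹ * m⁻¹, hcM⟩) = 1 := by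
      have e : (⟨l * m * l⁻¹ * m⁻¹, hcM⟩ : M) = ⟨l * m * l⁻¹, hnorm l hl m hm⟩ * ⟨m, hm⟩⁻¹ := rfl
      rw [e, map_mul, map_inv, hconj l hl ⟨m, hm⟩]
      simp only [map_mul, map_inv]
      have key : ∀ p q : ℤˣ, p * q * p⁻¹ * q⁻¹ = 1 := fun p q => by
        rw [mul_right_comm p q p⁻¹]; simp
      exact key _ _
    have hmemN : (⟨resM ⟨l * m * l⁻¹ * m⁻¹, hcM⟩, Perm.mem_alternatingGroup.2 hsign⟩ : A) ∈ N := by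
      rw [hN, Subgroup.mem_comap]
      exact ⟨_, rfl⟩
    rw [hbot, Subgroup.mem_bot] at hmemN
    have hc1 : resM ⟨l * m * l⁻¹ * m⁻¹, hcM⟩ = 1 := congrArg Subtype.val hmemN
    -- so `l m = m l` on `B`
    have hcomm : ∀ v ∈ B, l (m v) = m (l v) := by
      intro v hv
      have hw : m (l v) ∈ B := (hMB m hm _).2 ((hLB l hl v).2 hv)
      have := congrArg (fun f : Perm {u // u ∈ B} => ((f ⟨m (l v), hw⟩ : {u // u ∈ B}) : β)) hc1
      simpa [hresM, Perm.mul_apply] using this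
    apply hτm
    ext v
    rw [Perm.mul_apply, Perm.mul_apply]
    by_cases hv : v ∈ B
    · rw [← hlτ _ ((hMB m hm v).2 hv), hcomm v hv, hlτ v hv]
    · have hτv : τ v = v := apply_eq_self_of_not_mem hτB v hv
      have hmv : m v ∉ B := fun h => hv ((hMB m hm v).1 h)
      rw [hτv, apply_eq_self_of_not_mem hτB _ hmv]
  · ---------------------------------------------------------------- `M` is full on `B`
    right
    intro σ hσ hσB
    have hσp : ∀ u, σ u ∈ B ↔ u ∈ B := apply_mem_iff_of_moved_subset hσB
    set a : Perm {u // u ∈ B} := σ.subtypePerm hσp with ha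
    have hsa : sign a = 1 := by
      have h := sign_subtypePerm σ hσp hσB
      rw [hσ] at h
      rw [ha]
      convert h using 3
    have hmem : (⟨a, Perm.mem_alternatingGroup.2 hsa⟩ : A) ∈ N := by
      rw [htop]; exact Subgroup.mem_top _
    rw [hN, Subgroup.mem_comap] at hmem
    obtain ⟨m, hm⟩ := hmem
    refine ⟨m, m.2, fun u hu => ?_⟩
    have := congrArg (fun f : Perm {u // u ∈ B} => ((f ⟨u, hu⟩ : {u // u ∈ B}) : β)) hm
    simpa [hresM, ha] using this

namespace EST

variable {α : Type*} [Fintype α] [DecidableEq α]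

omit [Fintype α] [DecidableEq α] in
/-- **Counting through a restriction**: `|S| = |S ∩ Fix(p)| · |S|_p|` for a subgroup `S ≤ Sym(α)`
leaving the set `{x | p x}` invariant. -/
theorem card_eq_card_inf_fixing_mul_card_range (S : Subgroup (Perm α)) (p : α → Prop)
    (hp : ∀ s ∈ S, ∀ x, p (s x) ↔ p x) :
    Nat.card S = Nat.card ↥(S ⊓ fixingSubgroup (Perm α) {x | p x}) * Nat.card (restr S p hp).range := by
  rw [← (restr S p hp).ker.card_mul_index, Subgroup.index_ker]
  congr 1
  refine Nat.card_congr ?_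
  have hto : ∀ g : (restr S p hp).ker, ((g : S) : Perm α) ∈ fixingSubgroup (Perm α) {x | p x} := by
    intro g
    rw [mem_fixingSubgroup_iff]
    intro x hx
    have h1 : restr S p hp g = 1 := g.2
    have := congrArg (fun f : Perm {x // p x} => ((f ⟨x, hx⟩ : {x // p x}) : α)) h1
    simpa using this
  have hof : ∀ s : ↥(S ⊓ fixingSubgroup (Perm α) {x | p x}),
      (⟨s.1, (Subgroup.mem_inf.1 s.2).1⟩ : S) ∈ (restr S p hp).ker := by
    intro s
    rw [MonoidHom.mem_ker]
    ext ⟨x, hx⟩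
    have h2 := (mem_fixingSubgroup_iff (Perm α)).1 (Subgroup.mem_inf.1 s.2).2 x hx
    simpa using h2
  exact
    { toFun := fun g => ⟨(g : S), Subgroup.mem_inf.2 ⟨(g : S).2, hto g⟩⟩
      invFun := fun s => ⟨⟨s.1, (Subgroup.mem_inf.1 s.2).1⟩, hof s⟩
      left_inv := fun g => Subtype.ext (Subtype.ext rfl)
      right_inv := fun s => Subtype.ext rfl }

omit [Fintype α] [DecidableEq α] in
/-- Restriction is injective on a subgroup fixing the complement pointwise. -/
theorem card_range_restr_of_fix_compl (S : Subgroup (Perm α)) (p : α → Prop)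
    (hp : ∀ s ∈ S, ∀ x, p (s x) ↔ p x) (hfix : ∀ s ∈ S, ∀ x, ¬ p x → s x = x) :
    Nat.card (restr S p hp).range = Nat.card S := by
  refine (Nat.card_congr (Equiv.ofBijective (fun s : S => (⟨restr S p hp s, s, rfl⟩ : (restr S p hp).range))
    ⟨fun s s' h => ?_, fun t => ?_⟩)).symm
  · have h' : restr S p hp s = restr S p hp s' := congrArg Subtype.val h
    apply Subtype.ext
    ext x
    by_cases hx : p x
    · have := congrArg (fun f : Perm {x // p x} => ((f ⟨x, hx⟩ : {x // p x}) : α)) h'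
      simpa using this
    · rw [hfix _ s.2 x hx, hfix _ s'.2 x hx]
  · obtain ⟨t, s, rfl⟩ := t
    exact ⟨s, rfl⟩

omit [DecidableEq α] in
/-- **`|X| ≤ |B|! · |X ∩ Fix(B)|`** for a subgroup `X ≤ Sym(α)` leaving the finite set `B`
invariant (kernel and image of the restriction to `B`). -/
theorem card_le_factorial_mul_card_inf_fixing (X : Subgroup (Perm α)) (B : Finset α)
    (hXB : ∀ x ∈ X, ∀ u, x u ∈ B ↔ u ∈ B) :
    Nat.card X ≤ B.card.factorial * Nat.card ↥(X ⊓ fixingSubgroup (Perm α) (B : Set α)) := by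
  have h1 := card_eq_card_inf_fixing_mul_card_range X (fun u => u ∈ B) hXB
  have h2 : Nat.card (restr X (fun u => u ∈ B) hXB).range ≤ B.card.factorial :=
    calc Nat.card (restr X (fun u => u ∈ B) hXB).range ≤ Nat.card (Perm {u // u ∈ B}) :=
          Nat.card_le_card_of_injective _ Subtype.val_injective
      _ = B.card.factorial := by rw [Nat.card_perm, Nat.card_eq_fintype_card, Fintype.card_coe]
  have h3 : (B : Set α) = {u | u ∈ B} := rfl
  rw [h3, h1, mul_comm]
  exact Nat.mul_le_mul_right _ h2

end EST

end Summit.PneNP.PneNP.Theorems
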